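import Summits.BirchSwinnertonDyer.BirchSwinnertonDyer.Theorems.GenusKolyvaginAtTwoGenusPrimitiveSupplyAtTwoTwistSelmerStrictUp
import Summits.BirchSwinnertonDyer.BirchSwinnertonDyer.Theorems.GenusKolyvaginAtTwoGenusPrimitiveSupplyAtTwoPrimeHeegnerTwinDichotomy
import HarnessLib
import Summits.BirchSwinnertonDyer.BirchSwinnertonDyer.Theorems.GenusKolyvaginAtTwoGenusPrimitiveSupplyAtTwoTwistSelmerStrictUpEll

/-!
# Route `GenusKolyvaginAtTwo`, crux #2 `GenusPrimitiveSupplyAtTwo` (stmt-BirchSwinnertonDyer-22136):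
# the `V_T` DICHOTOMY at the prime of a prime Heegner field WITHOUT `MazurRubin2010.cor34i_singleton_rat` — both directions of
# Mazur–Rubin Cor. 3.4 (i) for the twin `E^{(d_K)}`, `d_K = −ℓ`, as kernel theorems modulo route print items

Width seat `bsd-line-gk2-p4` g9 (cell `bsd-f1-sign2`), fifteenth file of the twisting-prime series (crux workfile
`Lines/genus-supply-depth-class.md` §4). THEOREMS ONLY (no definition, no named fact, no `sorry`); helper
`--supports stmt-BirchSwinnertonDyer-22136`; no item is closed; BSD is not proved by any of this.

gk2-p5 g6's `GenusKolyTwin.cor34i_twin_prime_heegner` (p607245) consumes the print named fact `MazurRubin2010.cor34i_singleton_rat` (`h34`) in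
BOTH directions; its consumers are `natCard_selmerGroup_twin_eq_two_of_cor34i` (on `#Sel₂(W) = 1` the twin is `Sel₂`-minimal — uses UP) and
`natCard_selmerGroup_twin_eq_two_iff_not_strict` (on `#Sel₂(W) = 4` the twin is minimal iff NOT strict — uses both). The DOWN branch is
gk2-p5 g8's `GenusKolyTwistLocal.natCard_selmerGroup_eq_two_mul_of_not_le_strictLocalKer` (p624297, modulo {PT, Tate χ}); the UP branch is this seat's
`GenusKolyTwistLocal.natCard_selmerGroup_twin_eq_two_mul_of_le_strictLocalKer` (p628133, modulo {PT, Tate χ, 2-parity, Cassels–Tate,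
modularity} and `ρ̄_{W,2}` onto). This file restates the three GenusKolyTwin theorems with `h34` REPLACED by those displayed print items:

* `natCard_selmerGroup_twin_eq_two_mul_of_le_strictLocalKer_of_torsionBy_eq_bot` — the UP branch with the hypothesis `ρ̄_{W,2}` onto of
  p628133 weakened to what its proof uses, `W(ℚ)[2] = 0` (so that it also serves the `#Sel₂(W) = 1` cell, where `W(ℚ)[2] = 0` is automatic
  and `ρ̄₂` need not be onto);
* `cor34i_twin_prime_heegner_of_facts` — the dichotomy, same two conjuncts as p607245, hypotheses {PT, Tate χ, 2-parity, CT, modularity} +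
  `W(ℚ)[2] = 0`;
* `natCard_selmerGroup_twin_eq_two_of_facts` — `#Sel₂(W) = 1 ⟹ #Sel₂(Wd) = 2` (the `Ш[2]`-free rank-`0` cell: the prime Heegner twin is
  `Sel₂`-minimal), `W(ℚ)[2] = 0` being automatic (`mordellWeilRank_eq_zero_and_torsionBy_eq_bot_of_selmerGroup_eq_bot`);
* `natCard_selmerGroup_twin_eq_two_iff_not_strict_of_facts` — on `#Sel₂(W) = 4` (WALL row 1): `#Sel₂(Wd) = 2 ⟺ Sel₂(W)` NOT strict at `ℓ`.

References: [MazurRubin2010] Def. 3.1, Prop. 3.3, Cor. 3.4 (i), Thm. 2.7; [DokchitserDokchitserAnnals2010] Thm. 1.4; [MilneADT2006] I 2.8, 4.10,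
6.13; [GrossLMS1991] §1.
-/

set_option linter.dupNamespace false -- tree convention: `Summit.BirchSwinnertonDyer.BirchSwinnertonDyer.Theorems` (summit = sub-problem)
set_option autoImplicit false

noncomputable section

open scoped Classical AddSubgroup

open NumberField WeierstrassCurve Literature.NumberTheory.EllipticCurves Literature.NumberTheory.QuadraticFields
open IsDedekindDomain
open Literature.NumberTheory.GaloisCohomology Literature.NumberTheory.GaloisRepresentations
open Literature.NumberTheory.EllipticCurves.ModularForms (exists_isNewformOf)

namespace Summit.BirchSwinnertonDyer.BirchSwinnertonDyer.Theorems.GenusKolyTwin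

variable (W : WeierstrassCurve ℚ) [W.IsElliptic] [W.IsGloballyMinimal] {K : Type} [Field K] [NumberField K]

/-- **Cor. 3.4 (i) UP for the prime Heegner twin, with `W(ℚ)[2] = 0` in place of `ρ̄_{W,2}` onto** (the proof of
`GenusKolyTwistLocal.natCard_selmerGroup_twin_eq_two_mul_of_le_strictLocalKer` verbatim, its only use of surjectivity being
`W(ℚ)[2] = 0`): `W/ℚ` globally minimal, `Δ_W < 0`, `W(ℚ)[2] = 0`, `K` imaginary quadratic with `d_K = −ℓ` odd, Heegner for `N_W`, `2` split,
`Wd` any model of `W^{(d_K)}`, `Sel₂(W) ≤ MazurRubin2010.strictLocalKer W ℚ_ℓ 2` ⟹ `#Sel₂(Wd) = 2 · #Sel₂(W)`, granted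
{`poitouTate_selmerStructure_duality_real ℚ`, `localEulerPoincareCharacteristic`, `∀ V, p_parity V 2`, `exists_casselsTate_pairing`,
`exists_isNewformOf`}. [cite: MazurRubin2010, Prop. 3.3, Cor. 3.4 (i), Thm. 2.7] [cite: DokchitserDokchitserAnnals2010, Thm. 1.4]
[cite: MilneADT2006, I Thm. 4.10, I Thm. 6.13] -/
theorem natCard_selmerGroup_twin_eq_two_mul_of_le_strictLocalKer_of_torsionBy_eq_bot
    (hPT : poitouTate_selmerStructure_duality_real ℚ)
    (hEP : ∀ v : HeightOneSpectrum (𝓞 ℚ), localEulerPoincareCharacteristic (v.adicCompletion ℚ))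
    (hpar : ∀ V : WeierstrassCurve ℚ, p_parity V 2)
    (hCT : WeierstrassCurve.exists_casselsTate_pairing (K := ℚ)) (hmod : exists_isNewformOf)
    (hΔ : W.Δ < 0) (hW2 : W.toAffine.Point[(2 : ℤ)] = ⊥) (hK : IsImaginaryQuadratic K) (hodd : Odd (discr K))
    (hH : SatisfiesHeegnerHypothesis (W.conductorNorm ℤ) K) (h2K : ((Ideal.span {(2 : ℤ)}).primesOver (𝓞 K)).ncard = 2)
    {ℓ : ℕ} [Fact ℓ.Prime] (hd : discr K = -(ℓ : ℤ)) (Wd : WeierstrassCurve ℚ) [Wd.IsElliptic]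
    (hWd : ∃ C : VariableChange ℚ, C • W.quadraticTwist (discr K : ℚ) = Wd)
    (hs : W.selmerGroup 2 ≤ MazurRubin2010.strictLocalKer W ℚ_[ℓ] 2) :
    Nat.card (Wd.selmerGroup 2) = 2 * Nat.card (W.selmerGroup 2) := by
  haveI : Fact (Nat.Prime 2) := ⟨Nat.prime_two⟩
  have hd0 : (discr K : ℚ) ≠ 0 := by exact_mod_cast NumberField.discr_ne_zero K
  have hlo : Nat.card (W.selmerGroup 2) ∣ Nat.card (Wd.selmerGroup 2) :=
    GenusKolyTwistLocal.natCard_selmerGroup_dvd_twin_of_le_strictLocalKer W hΔ hK hH h2K hd Wd hWd hs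
  have hhi : Nat.card (Wd.selmerGroup 2) ∣ 2 * Nat.card (W.selmerGroup 2) :=
    GenusKolyTwistLocal.natCard_selmerGroup_twin_dvd_two_mul_of_le_strictLocalKer W hPT hEP hΔ hK hodd hH h2K hd Wd hWd hs
  obtain ⟨s, hsW⟩ := exists_natCard_selmerGroup_eq_pow W 2
  obtain ⟨s', hsWd⟩ := exists_natCard_selmerGroup_eq_pow Wd 2
  have hsW' : Nat.card (W.selmerGroup 2) = 2 ^ s := hsW
  have hsWd' : Nat.card (Wd.selmerGroup 2) = 2 ^ s' := hsWd
  rw [hsW', hsWd'] at hlo hhi ⊢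
  rw [← pow_succ'] at hhi
  have h1 : s ≤ s' := (Nat.pow_dvd_pow_iff_le_right one_lt_two).mp hlo
  have h2 : s' ≤ s + 1 := (Nat.pow_dvd_pow_iff_le_right one_lt_two).mp hhi
  obtain ⟨C, hC⟩ := hWd
  have hbotWd : Wd.toAffine.Point[(2 : ℤ)] = ⊥ :=
    Summit.BirchSwinnertonDyer.Uniform.U2.torsionBy_two_eq_bot_of_twist W hd0 Wd
      ⟨C⁻¹, by rw [← hC, smul_smul, inv_mul_cancel, one_smul]⟩ hW2
  have hwW : (-1 : ℤ) ^ s = W.rootNumber :=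
    GenusKolyTwistLocal.neg_one_pow_eq_rootNumber_of_torsionBy_two_eq_bot W (hpar W) hCT hW2 hsW'
  have hwWd : (-1 : ℤ) ^ s' = Wd.rootNumber :=
    GenusKolyTwistLocal.neg_one_pow_eq_rootNumber_of_torsionBy_two_eq_bot Wd (hpar Wd) hCT hbotWd hsWd'
  have htw : Wd.rootNumber = -W.rootNumber := by
    haveI := W.isElliptic_quadraticTwist hd0
    rw [← rootNumber_quadraticTwist_discr_eq_neg_of_exists_isNewformOf W K hmod hK hH, ← hC]
    exact rootNumber_smul_holds (W.quadraticTwist (discr K : ℚ)) C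
  have hne : s' ≠ s := by
    intro heq
    rw [heq, hwW] at hwWd
    rw [← hwWd] at htw
    have h0 : W.rootNumber = 0 := by linarith
    rw [← hwW] at h0
    exact (pow_ne_zero s (by norm_num : (-1 : ℤ) ≠ 0)) h0
  have hs' : s' = s + 1 := by omega
  rw [hs', pow_succ']

/-- **THE `V_T` DICHOTOMY AT THE PRIME OF A PRIME HEEGNER FIELD, WITHOUT `cor34i_singleton_rat`** — the two conjuncts of gk2-p5 g6's
`cor34i_twin_prime_heegner` (p607245) VERBATIM, with `h34` REPLACED by the displayed print items {Poitou–Tate duality (Milne I.4.10),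
Tate's local Euler characteristic (Milne I.2.8), the 2-parity theorem (route item `TwoParityDD`), the Cassels–Tate pairing (route item
`CasselsTatePairingRat`), modularity (route item `ModularityExistsNewform`)} and the extra binder `W(ℚ)[2] = 0` (automatic on the habitat,
`ρ̄₂` onto, and on `#Sel₂(W) = 1`). For `W/ℚ` globally minimal with `Δ_W < 0`, `K` imaginary quadratic with `d_K = −ℓ` odd, Heegner for `N_W`,
`2` split, `Wd` any model of `W^{(d_K)}`: `Sel₂(W)` strict at `ℓ` ⟹ `#Sel₂(Wd) = 2·#Sel₂(W)` (UP, p628133); not strict ⟹ `#Sel₂(W) =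
2·#Sel₂(Wd)` (DOWN, gk2-p5 p624297). [cite: MazurRubin2010, Def. 3.1, Prop. 3.3, Cor. 3.4 (i), Thm. 2.7] [cite: MilneADT2006, I Thm. 2.8, 4.10]
[cite: DokchitserDokchitserAnnals2010, Thm. 1.4] -/
theorem cor34i_twin_prime_heegner_of_facts
    (hPT : poitouTate_selmerStructure_duality_real ℚ)
    (hEP : ∀ v : HeightOneSpectrum (𝓞 ℚ), localEulerPoincareCharacteristic (v.adicCompletion ℚ))
    (hpar : ∀ V : WeierstrassCurve ℚ, p_parity V 2)
    (hCT : WeierstrassCurve.exists_casselsTate_pairing (K := ℚ)) (hmod : exists_isNewformOf)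
    (hΔ : W.Δ < 0) (hW2 : W.toAffine.Point[(2 : ℤ)] = ⊥) (hK : IsImaginaryQuadratic K) (hodd : Odd (discr K))
    (hH : SatisfiesHeegnerHypothesis (W.conductorNorm ℤ) K) (h2K : ((Ideal.span {(2 : ℤ)}).primesOver (𝓞 K)).ncard = 2)
    {ℓ : ℕ} [Fact ℓ.Prime] (hd : discr K = -(ℓ : ℤ)) (Wd : WeierstrassCurve ℚ) [Wd.IsElliptic]
    (hWd : ∃ C : VariableChange ℚ, C • W.quadraticTwist (discr K : ℚ) = Wd) :
    (W.selmerGroup 2 ≤ MazurRubin2010.strictLocalKer W ℚ_[ℓ] 2 →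
        Nat.card (Wd.selmerGroup 2) = 2 * Nat.card (W.selmerGroup 2)) ∧
      (¬ W.selmerGroup 2 ≤ MazurRubin2010.strictLocalKer W ℚ_[ℓ] 2 →
        Nat.card (W.selmerGroup 2) = 2 * Nat.card (Wd.selmerGroup 2)) :=
  ⟨fun hs ↦ natCard_selmerGroup_twin_eq_two_mul_of_le_strictLocalKer_of_torsionBy_eq_bot W hPT hEP hpar hCT hmod hΔ hW2 hK hodd
      hH h2K hd Wd hWd hs,
    fun hns ↦ GenusKolyTwistLocal.natCard_selmerGroup_eq_two_mul_of_not_le_strictLocalKer W hPT hEP hΔ hK hodd hH h2K hd Wd hWd hns⟩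

/-- **On `#Sel₂(W) = 1` the prime Heegner twin is `Sel₂`-minimal — WITHOUT `cor34i_singleton_rat`** (gk2-p5 g6's
`natCard_selmerGroup_twin_eq_two_of_cor34i` with `h34` replaced): the trivial Selmer group is strict at every place, so `#Sel₂(Wd) = 2` by
UP; `W(ℚ)[2] = 0` is automatic (`Sel₂(W) = 0` ⟹ `E(ℚ)/2 = 0` ⟹ `E(ℚ)[2] = 0`, `mordellWeilRank_eq_zero_and_torsionBy_eq_bot_of_selmerGroup_eq_bot`).
The `Ш[2]`-free rank-`0` cell of the habitat: its Heegner twin at every prime Heegner field is `2`-Selmer-minimal, modulo {PT, Tate χ,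
2-parity, CT, modularity}. [cite: MazurRubin2010, Cor. 3.4 (i)] [cite: DokchitserDokchitserAnnals2010, Thm. 1.4] -/
theorem natCard_selmerGroup_twin_eq_two_of_facts
    (hPT : poitouTate_selmerStructure_duality_real ℚ)
    (hEP : ∀ v : HeightOneSpectrum (𝓞 ℚ), localEulerPoincareCharacteristic (v.adicCompletion ℚ))
    (hpar : ∀ V : WeierstrassCurve ℚ, p_parity V 2)
    (hCT : WeierstrassCurve.exists_casselsTate_pairing (K := ℚ)) (hmod : exists_isNewformOf)
    (hΔ : W.Δ < 0) (hK : IsImaginaryQuadratic K) (hodd : Odd (discr K)) (hH : SatisfiesHeegnerHypothesis (W.conductorNorm ℤ) K)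
    (h2K : ((Ideal.span {(2 : ℤ)}).primesOver (𝓞 K)).ncard = 2) {ℓ : ℕ} [Fact ℓ.Prime] (hd : discr K = -(ℓ : ℤ))
    (Wd : WeierstrassCurve ℚ) [Wd.IsElliptic]
    (hWd : ∃ C : VariableChange ℚ, C • W.quadraticTwist (discr K : ℚ) = Wd)
    (h1 : Nat.card (W.selmerGroup 2) = 1) : Nat.card (Wd.selmerGroup 2) = 2 := by
  haveI : Fact (Nat.Prime 2) := ⟨Nat.prime_two⟩
  have hbot : W.selmerGroup 2 = ⊥ := AddSubgroup.eq_bot_of_card_eq (W.selmerGroup 2) h1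
  have hW2 : W.toAffine.Point[(2 : ℤ)] = ⊥ := by
    have h := (mordellWeilRank_eq_zero_and_torsionBy_eq_bot_of_selmerGroup_eq_bot W 2 (by exact_mod_cast hbot)).2
    -- (`E(ℚ)[2]` elaborates against `instDecidableEqRat` here, against the classical instance in the number-field lemma:
    -- transport along the subsingleton `DecidableEq ℚ` — tree idiom of `GaloisImage/KuriharaSelmerShaBookkeeping`)
    have hinst : (instDecidableEqRat : DecidableEq ℚ) = fun a b => Classical.propDecidable (a = b) :=
      Subsingleton.elim _ _
    rw [hinst]
    simpa using h
  have h := (cor34i_twin_prime_heegner_of_facts W hPT hEP hpar hCT hmod hΔ hW2 hK hodd hH h2K hd Wd hWd).1 (by rw [hbot]; exact bot_le)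
  rw [h1, mul_one] at h
  exact h

/-- **On the `#Sel₂(W) = 4` cells (`Ш(E)[2] ≅ (ℤ/2)²`, WALL row 1) the prime Heegner twin is `Sel₂`-minimal iff `Sel₂(W)` is NOT strict
at `ℓ` — WITHOUT `cor34i_singleton_rat`** (gk2-p5 g6's `natCard_selmerGroup_twin_eq_two_iff_not_strict` with `h34` replaced; `W(ℚ)[2] = 0` as a
binder, automatic on the habitat by `ρ̄₂` onto, `GenusKolyTwistLocal.torsionBy_two_eq_bot_of_hasSurjectiveModNGaloisRep_rat`). The DEF = 1
supply of a minimal twin on row 1 is therefore a ČEBOTAREV condition on `ℓ` (some class of `Sel₂(W)` locally non-trivial at `ℓ`), modulo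
the displayed print items only. [cite: MazurRubin2010, Cor. 3.4 (i)] [cite: DokchitserDokchitserAnnals2010, Thm. 1.4] -/
theorem natCard_selmerGroup_twin_eq_two_iff_not_strict_of_facts
    (hPT : poitouTate_selmerStructure_duality_real ℚ)
    (hEP : ∀ v : HeightOneSpectrum (𝓞 ℚ), localEulerPoincareCharacteristic (v.adicCompletion ℚ))
    (hpar : ∀ V : WeierstrassCurve ℚ, p_parity V 2)
    (hCT : WeierstrassCurve.exists_casselsTate_pairing (K := ℚ)) (hmod : exists_isNewformOf)
    (hΔ : W.Δ < 0) (hW2 : W.toAffine.Point[(2 : ℤ)] = ⊥) (hK : IsImaginaryQuadratic K) (hodd : Odd (discr K))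
    (hH : SatisfiesHeegnerHypothesis (W.conductorNorm ℤ) K) (h2K : ((Ideal.span {(2 : ℤ)}).primesOver (𝓞 K)).ncard = 2)
    {ℓ : ℕ} [Fact ℓ.Prime] (hd : discr K = -(ℓ : ℤ)) (Wd : WeierstrassCurve ℚ) [Wd.IsElliptic]
    (hWd : ∃ C : VariableChange ℚ, C • W.quadraticTwist (discr K : ℚ) = Wd)
    (h4 : Nat.card (W.selmerGroup 2) = 4) :
    Nat.card (Wd.selmerGroup 2) = 2 ↔ ¬ W.selmerGroup 2 ≤ MazurRubin2010.strictLocalKer W ℚ_[ℓ] 2 := by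
  obtain ⟨hstrict, hnot⟩ := cor34i_twin_prime_heegner_of_facts W hPT hEP hpar hCT hmod hΔ hW2 hK hodd hH h2K hd Wd hWd
  constructor
  · intro h2 hle
    have h := hstrict hle
    rw [h2, h4] at h
    norm_num at h
  · intro hn
    have h := hnot hn
    rw [h4] at h
    omega

/-- **Habitat form**: the same dichotomy consequence with `ρ̄_{W,2}` onto in place of `W(ℚ)[2] = 0`.
[cite: MazurRubin2010, Cor. 3.4 (i)] -/
theorem natCard_selmerGroup_twin_eq_two_iff_not_strict_of_facts_of_surj
    (hPT : poitouTate_selmerStructure_duality_real ℚ)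
    (hEP : ∀ v : HeightOneSpectrum (𝓞 ℚ), localEulerPoincareCharacteristic (v.adicCompletion ℚ))
    (hpar : ∀ V : WeierstrassCurve ℚ, p_parity V 2)
    (hCT : WeierstrassCurve.exists_casselsTate_pairing (K := ℚ)) (hmod : exists_isNewformOf)
    (hΔ : W.Δ < 0) (hsurj : W.HasSurjectiveModNGaloisRep 2) (hK : IsImaginaryQuadratic K) (hodd : Odd (discr K))
    (hH : SatisfiesHeegnerHypothesis (W.conductorNorm ℤ) K) (h2K : ((Ideal.span {(2 : ℤ)}).primesOver (𝓞 K)).ncard = 2)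
    {ℓ : ℕ} [Fact ℓ.Prime] (hd : discr K = -(ℓ : ℤ)) (Wd : WeierstrassCurve ℚ) [Wd.IsElliptic]
    (hWd : ∃ C : VariableChange ℚ, C • W.quadraticTwist (discr K : ℚ) = Wd)
    (h4 : Nat.card (W.selmerGroup 2) = 4) :
    Nat.card (Wd.selmerGroup 2) = 2 ↔ ¬ W.selmerGroup 2 ≤ MazurRubin2010.strictLocalKer W ℚ_[ℓ] 2 :=
  natCard_selmerGroup_twin_eq_two_iff_not_strict_of_facts W hPT hEP hpar hCT hmod hΔ
    (GenusKolyTwistLocal.torsionBy_two_eq_bot_of_hasSurjectiveModNGaloisRep_rat W hsurj) hK hodd hH h2K hd Wd hWd h4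

/-! ## R-128 retype (director-bsd 2026-08-29 17:42Z, T-Q381-1′; seat bsd-line-gk2-p2 g21): PRINT-FORM TWINS
Every theorem below is the byte-identical twin of the theorem of the same name without the trailing prime, with the ONE change
that the `2`-parity hypothesis is typed as print has it — `∀ (V : WeierstrassCurve ℚ) [V.IsElliptic], p_parity V 2`
(Dokchitser–Dokchitser 2010 Thm. 1.4, elliptic curves; = route item `TwoParityDD` after rev 34) — instead of the bare closure
`∀ V : WeierstrassCurve ℚ, p_parity V 2` over all Weierstrass cubics (singular ones included: off print, undischargeable).
Calls to other retyped theorems go to their primed twins; every application `hpar W` is at an elliptic curve, so the proofs are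
unchanged. The unprimed originals are kept (append-only tree) and are superseded by these. BSD is NOT proved by any of this. -/

/-- **R-128 retype** (director-bsd 2026-08-29, T-Q381-1′) of `natCard_selmerGroup_twin_eq_two_mul_of_le_strictLocalKer_of_torsionBy_eq_bot`: the SAME statement and proof with the `2`-parity hypothesis in PRINT form `∀ (V : WeierstrassCurve ℚ) [V.IsElliptic], p_parity V 2` (Dokchitser–Dokchitser 2010 Thm. 1.4 is about elliptic curves; the bare closure over all Weierstrass cubics was off print). **Cor. 3.4 (i) UP for the prime Heegner twin, with `W(ℚ)[2] = 0` in place of `ρ̄_{W,2}` onto** (the proof of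
`GenusKolyTwistLocal.natCard_selmerGroup_twin_eq_two_mul_of_le_strictLocalKer'` verbatim, its only use of surjectivity being
`W(ℚ)[2] = 0`): `W/ℚ` globally minimal, `Δ_W < 0`, `W(ℚ)[2] = 0`, `K` imaginary quadratic with `d_K = −ℓ` odd, Heegner for `N_W`, `2` split,
`Wd` any model of `W^{(d_K)}`, `Sel₂(W) ≤ MazurRubin2010.strictLocalKer W ℚ_ℓ 2` ⟹ `#Sel₂(Wd) = 2 · #Sel₂(W)`, granted
{`poitouTate_selmerStructure_duality_real ℚ`, `localEulerPoincareCharacteristic`, `∀ V, p_parity V 2`, `exists_casselsTate_pairing`,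
`exists_isNewformOf`}. [cite: MazurRubin2010, Prop. 3.3, Cor. 3.4 (i), Thm. 2.7] [cite: DokchitserDokchitserAnnals2010, Thm. 1.4]
[cite: MilneADT2006, I Thm. 4.10, I Thm. 6.13] -/
theorem natCard_selmerGroup_twin_eq_two_mul_of_le_strictLocalKer_of_torsionBy_eq_bot'
    (hPT : poitouTate_selmerStructure_duality_real ℚ)
    (hEP : ∀ v : HeightOneSpectrum (𝓞 ℚ), localEulerPoincareCharacteristic (v.adicCompletion ℚ))
    (hpar : ∀ (V : WeierstrassCurve ℚ) [V.IsElliptic], p_parity V 2)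
    (hCT : WeierstrassCurve.exists_casselsTate_pairing (K := ℚ)) (hmod : exists_isNewformOf)
    (hΔ : W.Δ < 0) (hW2 : W.toAffine.Point[(2 : ℤ)] = ⊥) (hK : IsImaginaryQuadratic K) (hodd : Odd (discr K))
    (hH : SatisfiesHeegnerHypothesis (W.conductorNorm ℤ) K) (h2K : ((Ideal.span {(2 : ℤ)}).primesOver (𝓞 K)).ncard = 2)
    {ℓ : ℕ} [Fact ℓ.Prime] (hd : discr K = -(ℓ : ℤ)) (Wd : WeierstrassCurve ℚ) [Wd.IsElliptic]
    (hWd : ∃ C : VariableChange ℚ, C • W.quadraticTwist (discr K : ℚ) = Wd)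
    (hs : W.selmerGroup 2 ≤ MazurRubin2010.strictLocalKer W ℚ_[ℓ] 2) :
    Nat.card (Wd.selmerGroup 2) = 2 * Nat.card (W.selmerGroup 2) := by
  haveI : Fact (Nat.Prime 2) := ⟨Nat.prime_two⟩
  have hd0 : (discr K : ℚ) ≠ 0 := by exact_mod_cast NumberField.discr_ne_zero K
  have hlo : Nat.card (W.selmerGroup 2) ∣ Nat.card (Wd.selmerGroup 2) :=
    GenusKolyTwistLocal.natCard_selmerGroup_dvd_twin_of_le_strictLocalKer W hΔ hK hH h2K hd Wd hWd hs
  have hhi : Nat.card (Wd.selmerGroup 2) ∣ 2 * Nat.card (W.selmerGroup 2) :=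
    GenusKolyTwistLocal.natCard_selmerGroup_twin_dvd_two_mul_of_le_strictLocalKer W hPT hEP hΔ hK hodd hH h2K hd Wd hWd hs
  obtain ⟨s, hsW⟩ := exists_natCard_selmerGroup_eq_pow W 2
  obtain ⟨s', hsWd⟩ := exists_natCard_selmerGroup_eq_pow Wd 2
  have hsW' : Nat.card (W.selmerGroup 2) = 2 ^ s := hsW
  have hsWd' : Nat.card (Wd.selmerGroup 2) = 2 ^ s' := hsWd
  rw [hsW', hsWd'] at hlo hhi ⊢
  rw [← pow_succ'] at hhi
  have h1 : s ≤ s' := (Nat.pow_dvd_pow_iff_le_right one_lt_two).mp hlo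
  have h2 : s' ≤ s + 1 := (Nat.pow_dvd_pow_iff_le_right one_lt_two).mp hhi
  obtain ⟨C, hC⟩ := hWd
  have hbotWd : Wd.toAffine.Point[(2 : ℤ)] = ⊥ :=
    Summit.BirchSwinnertonDyer.Uniform.U2.torsionBy_two_eq_bot_of_twist W hd0 Wd
      ⟨C⁻¹, by rw [← hC, smul_smul, inv_mul_cancel, one_smul]⟩ hW2
  have hwW : (-1 : ℤ) ^ s = W.rootNumber :=
    GenusKolyTwistLocal.neg_one_pow_eq_rootNumber_of_torsionBy_two_eq_bot W (hpar W) hCT hW2 hsW'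
  have hwWd : (-1 : ℤ) ^ s' = Wd.rootNumber :=
    GenusKolyTwistLocal.neg_one_pow_eq_rootNumber_of_torsionBy_two_eq_bot Wd (hpar Wd) hCT hbotWd hsWd'
  have htw : Wd.rootNumber = -W.rootNumber := by
    haveI := W.isElliptic_quadraticTwist hd0
    rw [← rootNumber_quadraticTwist_discr_eq_neg_of_exists_isNewformOf W K hmod hK hH, ← hC]
    exact rootNumber_smul_holds (W.quadraticTwist (discr K : ℚ)) C
  have hne : s' ≠ s := by
    intro heq
    rw [heq, hwW] at hwWd
    rw [← hwWd] at htw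
    have h0 : W.rootNumber = 0 := by linarith
    rw [← hwW] at h0
    exact (pow_ne_zero s (by norm_num : (-1 : ℤ) ≠ 0)) h0
  have hs' : s' = s + 1 := by omega
  rw [hs', pow_succ']

/-- **R-128 retype** (director-bsd 2026-08-29, T-Q381-1′) of `cor34i_twin_prime_heegner_of_facts`: the SAME statement and proof with the `2`-parity hypothesis in PRINT form `∀ (V : WeierstrassCurve ℚ) [V.IsElliptic], p_parity V 2` (Dokchitser–Dokchitser 2010 Thm. 1.4 is about elliptic curves; the bare closure over all Weierstrass cubics was off print). **THE `V_T` DICHOTOMY AT THE PRIME OF A PRIME HEEGNER FIELD, WITHOUT `cor34i_singleton_rat`** — the two conjuncts of gk2-p5 g6's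
`cor34i_twin_prime_heegner` (p607245) VERBATIM, with `h34` REPLACED by the displayed print items {Poitou–Tate duality (Milne I.4.10),
Tate's local Euler characteristic (Milne I.2.8), the 2-parity theorem (route item `TwoParityDD`), the Cassels–Tate pairing (route item
`CasselsTatePairingRat`), modularity (route item `ModularityExistsNewform`)} and the extra binder `W(ℚ)[2] = 0` (automatic on the habitat,
`ρ̄₂` onto, and on `#Sel₂(W) = 1`). For `W/ℚ` globally minimal with `Δ_W < 0`, `K` imaginary quadratic with `d_K = −ℓ` odd, Heegner for `N_W`,
`2` split, `Wd` any model of `W^{(d_K)}`: `Sel₂(W)` strict at `ℓ` ⟹ `#Sel₂(Wd) = 2·#Sel₂(W)` (UP, p628133); not strict ⟹ `#Sel₂(W) =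
2·#Sel₂(Wd)` (DOWN, gk2-p5 p624297). [cite: MazurRubin2010, Def. 3.1, Prop. 3.3, Cor. 3.4 (i), Thm. 2.7] [cite: MilneADT2006, I Thm. 2.8, 4.10]
[cite: DokchitserDokchitserAnnals2010, Thm. 1.4] -/
theorem cor34i_twin_prime_heegner_of_facts'
    (hPT : poitouTate_selmerStructure_duality_real ℚ)
    (hEP : ∀ v : HeightOneSpectrum (𝓞 ℚ), localEulerPoincareCharacteristic (v.adicCompletion ℚ))
    (hpar : ∀ (V : WeierstrassCurve ℚ) [V.IsElliptic], p_parity V 2)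
    (hCT : WeierstrassCurve.exists_casselsTate_pairing (K := ℚ)) (hmod : exists_isNewformOf)
    (hΔ : W.Δ < 0) (hW2 : W.toAffine.Point[(2 : ℤ)] = ⊥) (hK : IsImaginaryQuadratic K) (hodd : Odd (discr K))
    (hH : SatisfiesHeegnerHypothesis (W.conductorNorm ℤ) K) (h2K : ((Ideal.span {(2 : ℤ)}).primesOver (𝓞 K)).ncard = 2)
    {ℓ : ℕ} [Fact ℓ.Prime] (hd : discr K = -(ℓ : ℤ)) (Wd : WeierstrassCurve ℚ) [Wd.IsElliptic]
    (hWd : ∃ C : VariableChange ℚ, C • W.quadraticTwist (discr K : ℚ) = Wd) :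
    (W.selmerGroup 2 ≤ MazurRubin2010.strictLocalKer W ℚ_[ℓ] 2 →
        Nat.card (Wd.selmerGroup 2) = 2 * Nat.card (W.selmerGroup 2)) ∧
      (¬ W.selmerGroup 2 ≤ MazurRubin2010.strictLocalKer W ℚ_[ℓ] 2 →
        Nat.card (W.selmerGroup 2) = 2 * Nat.card (Wd.selmerGroup 2)) :=
  ⟨fun hs ↦ natCard_selmerGroup_twin_eq_two_mul_of_le_strictLocalKer_of_torsionBy_eq_bot' W hPT hEP hpar hCT hmod hΔ hW2 hK hodd
      hH h2K hd Wd hWd hs,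
    fun hns ↦ GenusKolyTwistLocal.natCard_selmerGroup_eq_two_mul_of_not_le_strictLocalKer W hPT hEP hΔ hK hodd hH h2K hd Wd hWd hns⟩

/-- **R-128 retype** (director-bsd 2026-08-29, T-Q381-1′) of `natCard_selmerGroup_twin_eq_two_of_facts`: the SAME statement and proof with the `2`-parity hypothesis in PRINT form `∀ (V : WeierstrassCurve ℚ) [V.IsElliptic], p_parity V 2` (Dokchitser–Dokchitser 2010 Thm. 1.4 is about elliptic curves; the bare closure over all Weierstrass cubics was off print). **On `#Sel₂(W) = 1` the prime Heegner twin is `Sel₂`-minimal — WITHOUT `cor34i_singleton_rat`** (gk2-p5 g6's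
`natCard_selmerGroup_twin_eq_two_of_cor34i` with `h34` replaced): the trivial Selmer group is strict at every place, so `#Sel₂(Wd) = 2` by
UP; `W(ℚ)[2] = 0` is automatic (`Sel₂(W) = 0` ⟹ `E(ℚ)/2 = 0` ⟹ `E(ℚ)[2] = 0`, `mordellWeilRank_eq_zero_and_torsionBy_eq_bot_of_selmerGroup_eq_bot`).
The `Ш[2]`-free rank-`0` cell of the habitat: its Heegner twin at every prime Heegner field is `2`-Selmer-minimal, modulo {PT, Tate χ,
2-parity, CT, modularity}. [cite: MazurRubin2010, Cor. 3.4 (i)] [cite: DokchitserDokchitserAnnals2010, Thm. 1.4] -/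
theorem natCard_selmerGroup_twin_eq_two_of_facts'
    (hPT : poitouTate_selmerStructure_duality_real ℚ)
    (hEP : ∀ v : HeightOneSpectrum (𝓞 ℚ), localEulerPoincareCharacteristic (v.adicCompletion ℚ))
    (hpar : ∀ (V : WeierstrassCurve ℚ) [V.IsElliptic], p_parity V 2)
    (hCT : WeierstrassCurve.exists_casselsTate_pairing (K := ℚ)) (hmod : exists_isNewformOf)
    (hΔ : W.Δ < 0) (hK : IsImaginaryQuadratic K) (hodd : Odd (discr K)) (hH : SatisfiesHeegnerHypothesis (W.conductorNorm ℤ) K)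
    (h2K : ((Ideal.span {(2 : ℤ)}).primesOver (𝓞 K)).ncard = 2) {ℓ : ℕ} [Fact ℓ.Prime] (hd : discr K = -(ℓ : ℤ))
    (Wd : WeierstrassCurve ℚ) [Wd.IsElliptic]
    (hWd : ∃ C : VariableChange ℚ, C • W.quadraticTwist (discr K : ℚ) = Wd)
    (h1 : Nat.card (W.selmerGroup 2) = 1) : Nat.card (Wd.selmerGroup 2) = 2 := by
  haveI : Fact (Nat.Prime 2) := ⟨Nat.prime_two⟩
  have hbot : W.selmerGroup 2 = ⊥ := AddSubgroup.eq_bot_of_card_eq (W.selmerGroup 2) h1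
  have hW2 : W.toAffine.Point[(2 : ℤ)] = ⊥ := by
    have h := (mordellWeilRank_eq_zero_and_torsionBy_eq_bot_of_selmerGroup_eq_bot W 2 (by exact_mod_cast hbot)).2
    -- (`E(ℚ)[2]` elaborates against `instDecidableEqRat` here, against the classical instance in the number-field lemma:
    -- transport along the subsingleton `DecidableEq ℚ` — tree idiom of `GaloisImage/KuriharaSelmerShaBookkeeping`)
    have hinst : (instDecidableEqRat : DecidableEq ℚ) = fun a b => Classical.propDecidable (a = b) :=
      Subsingleton.elim _ _
    rw [hinst]
    simpa using h
  have h := (cor34i_twin_prime_heegner_of_facts' W hPT hEP hpar hCT hmod hΔ hW2 hK hodd hH h2K hd Wd hWd).1 (by rw [hbot]; exact bot_le)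
  rw [h1, mul_one] at h
  exact h

/-- **R-128 retype** (director-bsd 2026-08-29, T-Q381-1′) of `natCard_selmerGroup_twin_eq_two_iff_not_strict_of_facts`: the SAME statement and proof with the `2`-parity hypothesis in PRINT form `∀ (V : WeierstrassCurve ℚ) [V.IsElliptic], p_parity V 2` (Dokchitser–Dokchitser 2010 Thm. 1.4 is about elliptic curves; the bare closure over all Weierstrass cubics was off print). **On the `#Sel₂(W) = 4` cells (`Ш(E)[2] ≅ (ℤ/2)²`, WALL row 1) the prime Heegner twin is `Sel₂`-minimal iff `Sel₂(W)` is NOT strict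
at `ℓ` — WITHOUT `cor34i_singleton_rat`** (gk2-p5 g6's `natCard_selmerGroup_twin_eq_two_iff_not_strict` with `h34` replaced; `W(ℚ)[2] = 0` as a
binder, automatic on the habitat by `ρ̄₂` onto, `GenusKolyTwistLocal.torsionBy_two_eq_bot_of_hasSurjectiveModNGaloisRep_rat`). The DEF = 1
supply of a minimal twin on row 1 is therefore a ČEBOTAREV condition on `ℓ` (some class of `Sel₂(W)` locally non-trivial at `ℓ`), modulo
the displayed print items only. [cite: MazurRubin2010, Cor. 3.4 (i)] [cite: DokchitserDokchitserAnnals2010, Thm. 1.4] -/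
theorem natCard_selmerGroup_twin_eq_two_iff_not_strict_of_facts'
    (hPT : poitouTate_selmerStructure_duality_real ℚ)
    (hEP : ∀ v : HeightOneSpectrum (𝓞 ℚ), localEulerPoincareCharacteristic (v.adicCompletion ℚ))
    (hpar : ∀ (V : WeierstrassCurve ℚ) [V.IsElliptic], p_parity V 2)
    (hCT : WeierstrassCurve.exists_casselsTate_pairing (K := ℚ)) (hmod : exists_isNewformOf)
    (hΔ : W.Δ < 0) (hW2 : W.toAffine.Point[(2 : ℤ)] = ⊥) (hK : IsImaginaryQuadratic K) (hodd : Odd (discr K))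
    (hH : SatisfiesHeegnerHypothesis (W.conductorNorm ℤ) K) (h2K : ((Ideal.span {(2 : ℤ)}).primesOver (𝓞 K)).ncard = 2)
    {ℓ : ℕ} [Fact ℓ.Prime] (hd : discr K = -(ℓ : ℤ)) (Wd : WeierstrassCurve ℚ) [Wd.IsElliptic]
    (hWd : ∃ C : VariableChange ℚ, C • W.quadraticTwist (discr K : ℚ) = Wd)
    (h4 : Nat.card (W.selmerGroup 2) = 4) :
    Nat.card (Wd.selmerGroup 2) = 2 ↔ ¬ W.selmerGroup 2 ≤ MazurRubin2010.strictLocalKer W ℚ_[ℓ] 2 := by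
  obtain ⟨hstrict, hnot⟩ := cor34i_twin_prime_heegner_of_facts' W hPT hEP hpar hCT hmod hΔ hW2 hK hodd hH h2K hd Wd hWd
  constructor
  · intro h2 hle
    have h := hstrict hle
    rw [h2, h4] at h
    norm_num at h
  · intro hn
    have h := hnot hn
    rw [h4] at h
    omega

/-- **R-128 retype** (director-bsd 2026-08-29, T-Q381-1′) of `natCard_selmerGroup_twin_eq_two_iff_not_strict_of_facts_of_surj`: the SAME statement and proof with the `2`-parity hypothesis in PRINT form `∀ (V : WeierstrassCurve ℚ) [V.IsElliptic], p_parity V 2` (Dokchitser–Dokchitser 2010 Thm. 1.4 is about elliptic curves; the bare closure over all Weierstrass cubics was off print). **Habitat form**: the same dichotomy consequence with `ρ̄_{W,2}` onto in place of `W(ℚ)[2] = 0`.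
[cite: MazurRubin2010, Cor. 3.4 (i)] -/
theorem natCard_selmerGroup_twin_eq_two_iff_not_strict_of_facts_of_surj'
    (hPT : poitouTate_selmerStructure_duality_real ℚ)
    (hEP : ∀ v : HeightOneSpectrum (𝓞 ℚ), localEulerPoincareCharacteristic (v.adicCompletion ℚ))
    (hpar : ∀ (V : WeierstrassCurve ℚ) [V.IsElliptic], p_parity V 2)
    (hCT : WeierstrassCurve.exists_casselsTate_pairing (K := ℚ)) (hmod : exists_isNewformOf)
    (hΔ : W.Δ < 0) (hsurj : W.HasSurjectiveModNGaloisRep 2) (hK : IsImaginaryQuadratic K) (hodd : Odd (discr K))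
    (hH : SatisfiesHeegnerHypothesis (W.conductorNorm ℤ) K) (h2K : ((Ideal.span {(2 : ℤ)}).primesOver (𝓞 K)).ncard = 2)
    {ℓ : ℕ} [Fact ℓ.Prime] (hd : discr K = -(ℓ : ℤ)) (Wd : WeierstrassCurve ℚ) [Wd.IsElliptic]
    (hWd : ∃ C : VariableChange ℚ, C • W.quadraticTwist (discr K : ℚ) = Wd)
    (h4 : Nat.card (W.selmerGroup 2) = 4) :
    Nat.card (Wd.selmerGroup 2) = 2 ↔ ¬ W.selmerGroup 2 ≤ MazurRubin2010.strictLocalKer W ℚ_[ℓ] 2 :=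
  natCard_selmerGroup_twin_eq_two_iff_not_strict_of_facts' W hPT hEP hpar hCT hmod hΔ
    (GenusKolyTwistLocal.torsionBy_two_eq_bot_of_hasSurjectiveModNGaloisRep_rat W hsurj) hK hodd hH h2K hd Wd hWd h4


end Summit.BirchSwinnertonDyer.BirchSwinnertonDyer.Theorems.GenusKolyTwin

end
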